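import Summits.ResolutionOfSingularities.ResolutionOfSingularities.Theorems.WildDescent9
import HarnessLib

/-!
# WildDescent (10/13) — β-descent in a linear frame; §8 Chain/Step part 1: `framePtsT`, `f_succ`, L3 `transported`

Verbatim slice of the farm-checked monolith `WildDescent.lean` of cell `decomp-res`, seat `decomp-res-lens-5`, g36
(sha256 4ec0fa6f4f9efba7…); one namespace `Summit.ResolutionOfSingularities.ResolutionOfSingularities.Theorems.WildDescent` across the
slices, imports chained (laws L1–L7 and the mechanism: module docstring of slice 1; main theorems: slice 13/13).
-/

open MvPolynomial Finset
open scoped BigOperators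
open Literature.AlgebraicGeometry.Resolution
open Literature.AlgebraicGeometry.Resolution.Hauser2010
open Literature.AlgebraicGeometry.Resolution.PointBlowup
open Literature.AlgebraicGeometry.Resolution.HauserPerlega2024

namespace Summit.ResolutionOfSingularities.ResolutionOfSingularities.Theorems.WildDescent

section Chain

variable {K : Type} [Field K]

variable {s : ℕ} {G : ℕ → MvPolynomial (Fin 3) K} {j : ℕ → Fin 3} {b : ℕ → Fin 3 → K} {k l f : ℕ → Fin 3} {c : ℕ → K}
  {ℓ : ℕ → MvPolynomial (Fin 3) K}

section Step

variable (hs : s ≠ 0) (hkl : ∀ n, k n ≠ l n) (hfk : ∀ n, f n ≠ k n) (hfl : ∀ n, f n ≠ l n)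
  (hrec : ∀ n, G (n + 1) = PointBlowup.translate (b n) (chartTransform s (j n) (G n)))
  (hordG : ∀ n, ordZero (G n) = s) (hc : ∀ n, c n ≠ 0) (hℓ : ∀ n, (ℓ n).IsHomogeneous 1)
  (hin : ∀ n, homogeneousComponent s (G n) = C (c n) * ℓ n ^ s)
  (htr : ∀ n, coeff (Finsupp.single (f n) 1) (ℓ n) ≠ 0) (hiso : ∀ n, NearCut.IsolatedMult s (G n))
  (hmove : ∀ n, j n = l n ∨ j n = f n) (hb : ∀ n i, i ≠ f (n + 1) → b n i = 0)
  (hwalls : ∀ n, (k (n + 1) = k n ∧ l (n + 1) = j n) ∨ (k (n + 1) = j n ∧ l (n + 1) = k n))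

/-- The `T`-image of `Δ_n`: `Φ(Δ_n)` if the lost wall sat in slot 2, `Ψ(Δ_n)` if in slot 1. DEFINITION (data). [new] -/
noncomputable def framePtsT (s : ℕ) (G ℓ : ℕ → MvPolynomial (Fin 3) K) (f k l j : ℕ → Fin 3) (n : ℕ) : Finset (ℚ × ℚ) :=
  if (slots (k 0) (l 0) l j n).2 = l n then (framePts s G ℓ f k l j n).image phi else (framePts s G ℓ f k l j n).image psi

/-- Symmetry of the two affine maps: `Ψ` is `Φ` conjugated by the coordinate swap. [folklore] -/
theorem psi_swap (z : ℚ × ℚ) : psi z.swap = (phi z).swap := by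
  simp only [psi, phi, Prod.swap]; ext <;> simp; ring

/-- Symmetry of the two affine maps: `Φ` is `Ψ` conjugated by the coordinate swap. [folklore] -/
theorem phi_swap (z : ℚ × ℚ) : phi z.swap = (psi z).swap := by
  simp only [psi, phi, Prod.swap]; ext <;> simp; ring

/-- Swapping the slots exchanges `Ψ(Δ(H; v,u; f))` and `Φ(Δ(H; u,v; f))` (reduces the `Ψ`-move laws to the `Φ`-move laws). [folklore] -/
theorem mem_image_psi_swap {σ : Type*} {H : MvPolynomial σ K} {s : ℕ} {f u v : σ} {y : ℚ × ℚ} :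
    y ∈ (pts s f v u H).image psi ↔ y.swap ∈ (pts s f u v H).image phi := by
  constructor
  · intro hy
    obtain ⟨z, hz, rfl⟩ := Finset.mem_image.mp hy
    exact Finset.mem_image.mpr ⟨z.swap, mem_pts_swap hz, by rw [phi_swap]⟩
  · intro hy
    obtain ⟨z, hz, hzy⟩ := Finset.mem_image.mp hy
    refine Finset.mem_image.mpr ⟨z.swap, mem_pts_swap hz, ?_⟩
    rw [psi_swap, hzy, Prod.swap_swap]

include hkl hfk hfl hwalls in
/-- The free letter of the next stage: unchanged after a wall chart, the lost wall after a free chart. [new] -/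
theorem f_succ (n : ℕ) : (j n = l n → f (n + 1) = f n) ∧ (j n = f n → f (n + 1) = l n) := by
  have h1 : f (n + 1) ≠ k n ∧ f (n + 1) ≠ j n := by
    rcases hwalls n with ⟨hk', hl'⟩ | ⟨hk', hl'⟩
    · exact ⟨hk' ▸ hfk (n + 1), hl' ▸ hfl (n + 1)⟩
    · exact ⟨hl' ▸ hfl (n + 1), hk' ▸ hfk (n + 1)⟩
  constructor
  · intro hj
    rcases fin3_exhaust (hfk n) (hfl n) (hkl n) (f (n + 1)) with h | h | h
    · exact h
    · exact absurd h h1.1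
    · exact absurd h (hj ▸ h1.2)
  · intro hj
    rcases fin3_exhaust (hfk n) (hfl n) (hkl n) (f (n + 1)) with h | h | h
    · exact absurd h (hj ▸ h1.2)
    · exact absurd h h1.1
    · exact h

include hs hkl hfk hfl hrec hordG hc hℓ hin htr hmove hb hwalls in
/-- **L3 · THE TRANSPORTED FRAME `H^new` of a move and its point laws** (`Δ(H^new) ⊆ ↑T(Δ_n)` and Pareto-minimal points
of `T(Δ_n)` survive), uniformly for wall charts (exact, §5) and free charts (§6). [new] -/
theorem transported (n : ℕ) : ∃ (Hn : MvPolynomial (Fin 3) K) (μ : K),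
    Hn = WallFrames.zshear (f (n + 1)) (-(C μ * X (k n))) (G (n + 1)) ∧
    (∀ x ∈ pts s (f (n + 1)) (slots (k 0) (l 0) l j (n + 1)).1 (slots (k 0) (l 0) l j (n + 1)).2 Hn,
        ∃ y ∈ framePtsT s G ℓ f k l j n, y.1 ≤ x.1 ∧ y.2 ≤ x.2) ∧
    (∀ w ∈ framePtsT s G ℓ f k l j n, (∀ z ∈ framePtsT s G ℓ f k l j n, z.1 ≤ w.1 → z.2 ≤ w.2 → z = w) →
        w ∈ pts s (f (n + 1)) (slots (k 0) (l 0) l j (n + 1)).1 (slots (k 0) (l 0) l j (n + 1)).2 Hn) := by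
  classical
  have hinH := frameH_in hkl hfk hfl hℓ hin htr n
  have hcH := frameH_c_ne hc htr (s := s) n
  have hordH := frameH_ord hfk hfl hordG (ℓ := ℓ) (k := k) (l := l) n
  have hG := G_eq_zshear_frameH hfk hfl (G := G) (ℓ := ℓ) (k := k) (l := l) n
  have hnear : (1 : ℕ∞) ≤ ordZero (G (n + 1)) := by
    rw [hordG]; exact_mod_cast Nat.pos_of_ne_zero hs
  have hslots := slots_spec hkl hwalls (j := j) n
  set ak := coeff (Finsupp.single (k n) 1) (ℓ n) / coeff (Finsupp.single (f n) 1) (ℓ n) with hak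
  set al := coeff (Finsupp.single (l n) 1) (ℓ n) / coeff (Finsupp.single (f n) 1) (ℓ n) with hal
  rcases hmove n with hj | hj
  · -- WALL CHART `j n = l n`
    have hfn := (f_succ hkl hfk hfl hwalls n).1 hj
    have hbn : ∀ i, i ≠ f n → b n i = 0 := fun i hi => hb n i (by rw [hfn]; exact hi)
    have hG1 : G (n + 1) = PointBlowup.translate (b n) (chartTransform s (l n)
        (WallFrames.zshear (f n) (C ak * X (k n) + C al * X (l n)) (frameH G ℓ f k l n))) := by
      rw [hrec, hj, ← hG]
    rw [hG1] at hnear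
    obtain ⟨_, hW⟩ := wall_step (hfk n) (hfl n) (hkl n) hs hcH hinH hordH hbn hnear
    have hsl : slots (k 0) (l 0) l j (n + 1) = slots (k 0) (l 0) l j n := by
      rw [slots_succ]
      rcases hslots with ⟨hu, hv⟩ | ⟨hu, hv⟩
      · rw [if_neg (by rw [hu]; exact hkl n), hj, ← hv]
      · rw [if_pos hu, hj, ← hu]
    refine ⟨chartTransform s (l n) (frameH G ℓ f k l n), ak, ?_, ?_, ?_⟩
    · rw [hfn, hG1, hW]
    · intro x hx
      refine ⟨x, ?_, le_rfl, le_rfl⟩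
      rw [hsl, hfn] at hx
      unfold framePtsT framePts
      rcases hslots with ⟨hu, hv⟩ | ⟨hu, hv⟩
      · rw [if_pos hv, hu, hv]
        rw [hu, hv, pts_chartTransform_snd (hfk n) (hfl n) (hkl n) hordH.symm.le] at hx
        exact hx
      · rw [if_neg (by rw [hv]; exact hkl n), hu, hv]
        rw [hu, hv, pts_chartTransform_fst (hfl n) (hfk n) (hkl n).symm hordH.symm.le] at hx
        exact hx
    · intro w hw _
      rw [hsl, hfn]
      unfold framePtsT framePts at hw
      rcases hslots with ⟨hu, hv⟩ | ⟨hu, hv⟩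
      · rw [if_pos hv, hu, hv] at hw
        rw [hu, hv, pts_chartTransform_snd (hfk n) (hfl n) (hkl n) hordH.symm.le]
        exact hw
      · rw [if_neg (by rw [hv]; exact hkl n), hu, hv] at hw
        rw [hu, hv, pts_chartTransform_fst (hfl n) (hfk n) (hkl n).symm hordH.symm.le]
        exact hw
  · -- FREE CHART `j n = f n`
    have hfn := (f_succ hkl hfk hfl hwalls n).2 hj
    have hbn : ∀ i, i ≠ l n → b n i = 0 := fun i hi => hb n i (by rw [hfn]; exact hi)
    have hG1 : G (n + 1) = PointBlowup.translate (b n) (chartTransform s (f n)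
        (WallFrames.zshear (f n) (C ak * X (k n) + C al * X (l n)) (frameH G ℓ f k l n))) := by
      rw [hrec, hj, ← hG]
    rw [hG1] at hnear
    obtain ⟨hκ, hF⟩ := free_step (hfk n) (hfl n) (hkl n) hs hcH hinH hordH hbn hnear
    have hal0 : al ≠ 0 := by rintro h0; rw [h0, zero_mul, add_zero] at hκ; exact one_ne_zero hκ
    have hβ0 : b n (l n) ≠ 0 := by rintro h0; rw [h0, mul_zero, add_zero] at hκ; exact one_ne_zero hκ
    rw [free_expansion (hfk n) (hfl n) (hkl n)] at hF
    set Hn := WallFrames.zshear (l n) (-(C (ak / al) * X (k n))) (PointBlowup.translate (b n) (chartTransform s (f n)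
        (WallFrames.zshear (f n) (C ak * X (k n) + C al * X (l n)) (frameH G ℓ f k l n)))) with hHn
    refine ⟨Hn, ak / al, ?_, ?_, ?_⟩
    · rw [hfn, hG1]
    · intro x hx
      rw [slots_succ, hfn] at hx
      unfold framePtsT framePts
      rcases hslots with ⟨hu, hv⟩ | ⟨hu, hv⟩
      · rw [if_pos hv, hu, hv]
        rw [if_neg (by rw [hu]; exact hkl n), hu, hj] at hx
        exact free_pts_up (hfk n) (hfl n) (hkl n) hordH.symm.le hF x hx
      · rw [if_neg (by rw [hv]; exact hkl n), hu, hv]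
        rw [if_pos hu, hv, hj] at hx
        obtain ⟨y, hy, hy1, hy2⟩ := free_pts_up (hfk n) (hfl n) (hkl n) hordH.symm.le hF x.swap (mem_pts_swap hx)
        refine ⟨y.swap, mem_image_psi_swap.mpr (by rw [Prod.swap_swap]; exact hy), ?_, ?_⟩
        · simpa using hy2
        · simpa using hy1
    · intro w hw hmin
      rw [slots_succ, hfn]
      unfold framePtsT framePts at hw hmin
      rcases hslots with ⟨hu, hv⟩ | ⟨hu, hv⟩
      · rw [if_pos hv, hu, hv] at hw hmin
        rw [if_neg (by rw [hu]; exact hkl n), hu, hj]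
        exact free_pts_min (hfk n) (hfl n) (hkl n) hinH hordH.symm.le hal0 hβ0 hF hw hmin
      · rw [if_neg (by rw [hv]; exact hkl n), hu, hv] at hw hmin
        rw [if_pos hu, hv, hj]
        have hw' : w.swap ∈ (pts s (f n) (k n) (l n) (frameH G ℓ f k l n)).image phi := mem_image_psi_swap.mp hw
        have hmin' : ∀ z ∈ (pts s (f n) (k n) (l n) (frameH G ℓ f k l n)).image phi,
            z.1 ≤ w.swap.1 → z.2 ≤ w.swap.2 → z = w.swap := by
          intro z hz hz1 hz2
          have hz' : z.swap ∈ (pts s (f n) (l n) (k n) (frameH G ℓ f k l n)).image psi :=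
            mem_image_psi_swap.mpr (by rw [Prod.swap_swap]; exact hz)
          have := hmin z.swap hz' (by simpa using hz2) (by simpa using hz1)
          rw [← this, Prod.swap_swap]
        have := free_pts_min (hfk n) (hfl n) (hkl n) hinH hordH.symm.le hal0 hβ0 hF hw' hmin'
        simpa using mem_pts_swap this

end Step

end Chain

end Summit.ResolutionOfSingularities.ResolutionOfSingularities.Theorems.WildDescent
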